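/-
Copyright (c) 2026. All rights reserved.
Released under Apache 2.0 license as described in the file LICENSE.
Authors: abc-iut cell, statement-typer seat abc-iut-L4-t3 (wave 1).
-/
import Literature.AnabelianGeometry.AbsoluteAnabelian.TPairs
import Literature.AnabelianGeometry.AbsoluteAnabelian.PanalocalTheaters
import HarnessLib

/-!
# [AbsTopIII] Definition 5.1 (vi) (the category `Th✠_T`) and Corollary 5.2 (vi), (vii): panalocal `T`-pairs

S. Mochizuki, *Topics in absolute anabelian geometry III: global reconstruction algorithms*,
J. Math. Sci. Univ. Tokyo 22 (2015) 939–1156 [MochizukiAbsTopIII2015]; locators `p.N` = pages of the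
author's manuscript (`paper:url-5493eb38cbb7`; journal pagination not held), read on the page: Def 5.1 (vi) p. 118,
Cor 5.2 (vi) p. 120, (vii) pp. 120–121 (proof p. 121), Rmk 5.2.1 p. 121; Def 3.1 (vi) p. 70 (`Anab`), Def 4.1 (v)
(`LinHol`) for the inputs of (vii).

Continuation of `TPairs.lean` (Def 5.1 (v), Cor 5.2 (ii)–(iv); the DATA level `PanalocalTPairData` of Def 5.1 (vi))
and `PanalocalTheaters.lean` (Def 5.1 (iv): `PanalocalGaloisTheater`, Cor 5.2 (v)), over the same interface
`TPairVocabulary R T`: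
* Def 5.1 (vi) proper: a **panalocal `T`-pair** `M✠ = (V✠, {(Π_v ↷ M_v)}_{v ∈ V^non}, {(X_v ↶κ M_v)}_{v ∈ V^arc})` =
  `PanalocalTPair` (a panalocal Galois-theater with local `T`-pair data indexed by ITS `V^non`, `V^arc`); morphisms
  (`PanalocalTPair.Hom`: a morphism of panalocal Galois-theaters with compatible `T`-isomorphisms); the
  panalocalization functor `Th⊚_T → Th✠_T` as the RELATION `PanalocalTPair.IsPanalocalizationOf` ("`M✠` is [isomorphic
  to] the panalocalization `{M⊚}✠`": the theater is a panalocalization of `V⊚(Π)` and the local data over each class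
  are identified, as orbi-pairs, with the local data of `M⊚` at a lift) — the functor is only determined up to
  isomorphism in the representative-based modelling of `Orb(−)` (as in `PanalocalTheaters.lean`), whence relation +
  named facts: `PanalocalTPairExists` (object part), `PanalocalTPairMapsHom` (morphism part, weak form),
  `PanalocalTPairEssSurj` ("which is essentially surjective");
* Cor 5.2 (vi): `An⊚[Th✠_T]` has objects `M✠_T(Π) = (Π, {M⊚_T(Π)}✠)` and "morphisms induced by morphisms of `EA⊚`";
  in this modelling `An⊚[Th✠_T]` IS `EA⊚` with decorated objects, so "the first arrow `EA⊚ → An⊚[Th✠_T]` is an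
  equivalence" is tautological; the typed content is the existence of `{M⊚_T(Π)}✠` (`PanalocalTPairExists` at the
  canonical pair `W.canonical Π`, Cor 5.2 (iv)) and the induced morphisms (`PanalocalTPairMapsHom`);
* Cor 5.2 (vii): `An✠[Th✠_T]` — replace `Π_v ∈ Orb(TG)` by the `Orb(Anab)`-object it determines and `X_v ∈ Orb(EA)` by
  its `Orb(LinHol)`-object, then apply `(−)_T`: the INTERFACE `PanalocalReconstruction W` (the object maps
  `Orb(TG) → T`, `Orb(EA) → T` with action / Kummer structure; owners of `Anab`, `LinHol`: abc-iut-L4-t2 — TODO-merge)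
  and the CONSTRUCTION `PanalocalReconstruction.canonical V✠` of the canonical panalocal `T`-pair of a panalocal
  Galois-theater (object map of `Th✠ → An✠[Th✠_T] → Th✠_T`); "all of which are equivalences of categories" = the named
  facts `PanalocalTPairIsoCanonical` (every panalocal `T`-pair is `T`-isomorphic over the identity of its theater to
  the canonical one), `PanalocalTPairHomDetermined` (a morphism of panalocal `T`-pairs is determined by its theater
  part: faithfulness of `Th✠_T → Th✠`; Prop 3.2 (ii), (iv) and "`κ_v`") and `PanalocalTheaterHomLifts` (fullness).

NOT here: Rmk 5.2.1 ("neither `EA⊚ → Th✠` nor `EA⊚ → Th✠_T` is an equivalence" — recorded by abc-iut-L4-t17,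
`RemarksLogFrobenius.lean`); the MAIN clause of Cor 5.2 (iii) (functorial Kummer map; separate file). All named
`Prop`s are ASSUMPTIONS on the interface data `(R, W[, A])`, true for the genuine context of Thm 1.9 / Cor 1.10 /
Cor 2.7–2.9, not facts about arbitrary vocabularies. Refereed pre-IUT anabelian geometry; nothing here bears on
[IUTchIII] Cor. 3.12; typed ≠ discharged.
-/

set_option autoImplicit false

universe u

open CategoryTheory Topology

namespace Literature.AnabelianGeometry.AbsoluteAnabelian

/-! ## The identity morphism of a panalocal Galois-theater -/

namespace PanalocalGaloisTheater

variable {R : GlobalAnabelianContext.{u}}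

/-- the identity of `TG`/`TG⊢` is an open injection. [cite: MochizukiAbsTopIII2015, Def 5.1 (iv) p. 116] -/
theorem isOpenInjection_id (G : ProfiniteGrp.{u}) : IsOpenInjection (ContinuousMonoidHom.id G) :=
  ⟨fun _ _ h => h, by
    rw [show Set.range (ContinuousMonoidHom.id G) = Set.univ from Set.range_eq_univ.mpr fun x => ⟨x, rfl⟩]
    exact isOpen_univ⟩

/-- the identity morphism of a panalocal Galois-theater (identity bijection, identity open injections, identity
isomorphisms of the `X_v`). [cite: MochizukiAbsTopIII2015, Def 5.1 (iv) p. 116] -/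
noncomputable def Hom.refl (V : PanalocalGaloisTheater R) : Hom V V where
  φV := Equiv.refl _
  φV_generic := rfl
  image_non := by simp
  image_arc := by simp
  non_mem v := v.2
  arc_mem v := v.2
  grpHom v := ContinuousMonoidHom.id (V.grp v)
  grpHom_isOpenInjection v := isOpenInjection_id (V.grp v)
  archIso _ := ⟨Homeomorph.refl _, RingEquiv.refl _, ContinuousMulEquiv.refl _⟩

end PanalocalGaloisTheater

section

variable {R : GlobalAnabelianContext.{u}} {T : TKind} (W : TPairVocabulary R T)

/-! ## Def 5.1 (vi): panalocal `T`-pairs, the objects and morphisms of `Th✠_T` -/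

/-- **Def 5.1 (vi)**: a **panalocal `T`-pair** `M✠ := (V✠, {(Π_v ↷ M_v)}_{v ∈ V^non}, {(X_v ↶κ M_v)}_{v ∈ V^arc})` —
a panalocal Galois-theater `V✠ = (V⊚, {Π_v}, {X_v})` together with, for each `v ∈ V^non`, an [orbi-]MLF-Galois `T`-pair
with Galois group `Π_v` and, for each `v ∈ V^arc`, an [orbi-]Aut-holomorphic `T`-pair with structure-orbispace `X_v`.
[cite: MochizukiAbsTopIII2015, Def 5.1 (vi) p. 118] -/
structure PanalocalTPair : Type (u + 1) where
  /-- the underlying panalocal Galois-theater `V✠` -/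
  theater : PanalocalGaloisTheater R
  /-- the local `T`-pair data `(Π_v ↷ M_v)`, `(X_v ↶κ M_v)` indexed by `V^non`, `V^arc` of `V✠` -/
  data : PanalocalTPairData W theater.non theater.arc theater.grp theater.X

/-- **Def 5.1 (vi)**: a **morphism of panalocal `T`-pairs** — a morphism `φ_{V✠}` of panalocal Galois-theaters together
with compatible `T`-isomorphisms of [orbi-]MLF-Galois `T`-pairs `φ_{v₁} : (M₁)_{v₁} ⥲ (M₂)_{v₂}` (`v₁ ↦ v₂` nonarchimedean;
compatible with the actions along the open injection `(Π₁)_{v₁} ↪ (Π₂)_{v₂}` of `φ_{V✠}`) and of [orbi-]Aut-holomorphic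
`T`-pairs (`v₁ ↦ v₂` archimedean; compatible with the Kummer structures along the isomorphism `(X₁)_{v₁} ⥲ (X₂)_{v₂}` of
`φ_{V✠}`). [cite: MochizukiAbsTopIII2015, Def 5.1 (vi) p. 118] -/
structure PanalocalTPair.Hom (Q₁ Q₂ : PanalocalTPair W) : Type u where
  /-- `φ_{V✠}` -/
  φV : PanalocalGaloisTheater.Hom Q₁.theater Q₂.theater
  /-- `φ_{v₁} : (M₁)_{v₁} ⥲ (M₂)_{v₂}`, `v₁` nonarchimedean -/
  φnon : ∀ v : Q₁.theater.non, Q₁.data.Mnon v ≅ Q₂.data.Mnon ⟨φV.φV v, φV.non_mem v⟩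
  /-- compatibility with the actions along `(Π₁)_{v₁} ↪ (Π₂)_{v₂}` -/
  φnon_equivariant : ∀ (v : Q₁.theater.non) (g : Q₁.theater.grp v),
    (Q₁.data.actNon v g).hom ≫ (φnon v).hom =
      (φnon v).hom ≫ (Q₂.data.actNon ⟨φV.φV v, φV.non_mem v⟩ (φV.grpHom v g)).hom
  /-- `φ_{v₁} : (M₁)_{v₁} ⥲ (M₂)_{v₂}`, `v₁` archimedean -/
  φarc : ∀ v : Q₁.theater.arc, Q₁.data.Marc v ≅ Q₂.data.Marc ⟨φV.φV v, φV.arc_mem v⟩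
  /-- compatibility with the Kummer structures along `(X₁)_{v₁} ⥲ (X₂)_{v₂}` -/
  φarc_kummer : ∀ v : Q₁.theater.arc,
    W.kummerTransport (φV.archIso v) (φarc v) (Q₁.data.kummer v) = Q₂.data.kummer ⟨φV.φV v, φV.arc_mem v⟩

/-- **Def 5.1 (vi), the panalocalization functor `Th⊚_T → Th✠_T`** (object part, as a relation): "`M✠` is [isomorphic
to] the panalocalization `{M⊚}✠` of the global `T`-pair `M⊚`" — its theater is a panalocalization of `V⊚(Π)` (reference
bijection `ψ : V⊚(Π)/Aut(Π) ⥲ V⊚`, Def 5.1 (iv)) and, `ψ_V : V⊚(Π) ⥲ V̄⊚` being the reference isomorphism of `M⊚`, the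
[orbi-]pair of `M✠` at the class of a local element `ṽ` is identified with the pair `((Π_{v̄} ↷ M_{v̄})`, resp.
`(X_{v̄} ↶κ M_{v̄})`) of `M⊚` at `v̄ := ψ_V(ṽ)`: a `T`-isomorphism equivariant along an isomorphism of the groups, resp.
Kummer-compatible along an isomorphism of the orbispaces. [cite: MochizukiAbsTopIII2015, Def 5.1 (vi) p. 118] -/
def PanalocalTPair.IsPanalocalizationOf (Q : PanalocalTPair W) (M : GlobalTPair W) : Prop :=
  ∃ (ψV : (R.proVal M.theater.ext).carrier ≃ₜ M.theater.V.carrier) (_ : M.theater.IsReferenceIso ψV)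
    (ψ : R.ProValModAut M.theater.ext ≃ Q.theater.V)
    (_ : IsPanalocalReferenceFor R Q.theater.generic Q.theater.non Q.theater.arc Q.theater.grp Q.theater.X
      M.theater.ext ψ),
    (∀ (vl : (R.proVal M.theater.ext).carrier) (hvl : ψV vl ∈ M.theater.V.non)
        (hc : ψ (R.toModAut M.theater.ext vl) ∈ Q.theater.non),
      ∃ (e : M.theater.V.decompGrp (ψV vl) ≃ₜ* Q.theater.grp ⟨_, hc⟩)
        (φ : M.Mnon ⟨ψV vl, hvl⟩ ≅ Q.data.Mnon ⟨_, hc⟩),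
        ∀ g, (M.actNon ⟨ψV vl, hvl⟩ g).hom ≫ φ.hom = φ.hom ≫ (Q.data.actNon ⟨_, hc⟩ (e g)).hom) ∧
    (∀ (vl : (R.proVal M.theater.ext).carrier) (hvl : ψV vl ∈ M.theater.V.arc)
        (hc : ψ (R.toModAut M.theater.ext vl) ∈ Q.theater.arc),
      ∃ (x : AutHolOrbispace.Iso (M.theater.X ⟨ψV vl, hvl⟩) (Q.theater.X ⟨_, hc⟩))
        (φ : M.Marc ⟨ψV vl, hvl⟩ ≅ Q.data.Marc ⟨_, hc⟩),
        W.kummerTransport x φ (M.kummer ⟨ψV vl, hvl⟩) = Q.data.kummer ⟨_, hc⟩)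

/-- **Def 5.1 (vi) / Cor 5.2 (vi), object part** (named fact; assumption on `(R, W)`): every global `T`-pair `M⊚` has a
panalocalization `{M⊚}✠ ∈ Ob(Th✠_T)`; in particular, for `Π ∈ Ob(EA⊚)`, `M✠_T(Π) := (Π, {M⊚_T(Π)}✠)` — the object of
`An⊚[Th✠_T]` over `Π` — exists (take `M⊚ := M⊚_T(Π)`, `TPairVocabulary.canonical`). In the present modelling
`An⊚[Th✠_T]` ("morphisms induced by morphisms of `EA⊚`") is `EA⊚` with decorated objects, so "the first arrow
`EA⊚ → An⊚[Th✠_T]` is an equivalence of categories" carries no further content. [cite: MochizukiAbsTopIII2015, Cor 5.2 (vi) p. 120] -/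
def PanalocalTPairExists : Prop :=
  ∀ M : GlobalTPair W, ∃ Q : PanalocalTPair W, Q.IsPanalocalizationOf W M

/-- **Def 5.1 (vi) / Cor 5.2 (vi), morphism part, WEAK FORM** (named fact; assumption on `(R, W)`): a morphism of global
`T`-pairs induces a morphism between panalocalizations (the functor `Th⊚_T → Th✠_T` "lying over `Th⊚ → Th✠`"; the second
arrow `An⊚[Th✠_T] → Th✠_T` "forgetting the way in which the data arose from `Π`" on morphisms). Existence only, as for
`PanalocalizationMapsHom` (Cor 5.2 (v)). [cite: MochizukiAbsTopIII2015, Cor 5.2 (vi) p. 120] -/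
def PanalocalTPairMapsHom : Prop :=
  ∀ (M₁ M₂ : GlobalTPair W) (Q₁ Q₂ : PanalocalTPair W), Q₁.IsPanalocalizationOf W M₁ →
    Q₂.IsPanalocalizationOf W M₂ → ∀ _φ : GlobalTPair.Hom W M₁ M₂, Nonempty (PanalocalTPair.Hom W Q₁ Q₂)

/-- **Def 5.1 (vi)** (named fact; assumption on `(R, W)`): the panalocalization functor `Th⊚_T → Th✠_T` "is essentially
surjective" — every panalocal `T`-pair is isomorphic to the panalocalization of a global one.
[cite: MochizukiAbsTopIII2015, Def 5.1 (vi) p. 118] -/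
def PanalocalTPairEssSurj : Prop :=
  ∀ Q : PanalocalTPair W, ∃ M : GlobalTPair W, Q.IsPanalocalizationOf W M

/-! ## Cor 5.2 (vii): `An✠[Th✠_T]` and the equivalences `Th✠ → An✠[Th✠_T] → Th✠_T → Th✠` -/

/-- INTERFACE for Cor 5.2 (vii) (owners of `Anab`, `LinHol`: abc-iut-L4-t2 — TODO-merge): "[the result of applying
`(−)_T` to] the data that constitutes the corresponding object of `Orb(Anab)` [cf. Definition 3.1, (vi)] (respectively,
`Orb(LinHol)` [cf. Definition 4.1, (v)])" of an object of `Orb(TG)` (respectively, `Orb(EA)`): for a profinite group `D`,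
the arithmetic data `M_T(D) ∈ Ob(T)` reconstructed group-theoretically (Cor 1.10 (d), (h): `k̄^× ↪ lim→_J H¹(J, μ_Ẑ(D))`
with its field structure) with its `D`-action; for an Aut-holomorphic orbispace `X`, the arithmetic data with its
Kummer structure (Cor 2.7). [cite: MochizukiAbsTopIII2015, Cor 5.2 (vii) p. 120] -/
structure PanalocalReconstruction : Type (u + 1) where
  /-- `Orb(TG) → Orb(Anab) → T` on objects: `D ↦ M_T(D)` -/
  anabData : ProfiniteGrp.{u} → W.LocObj
  /-- the tautological action `D ↷ M_T(D)` -/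
  anabAct : ∀ D : ProfiniteGrp.{u}, D →* Aut (anabData D)
  /-- `Orb(EA) → Orb(LinHol) → T` on objects: `X ↦ M_T(X)` -/
  linHolData : AutHolOrbispace.{u} → W.LocObj
  /-- the Kummer structure `X ↶κ M_T(X)` -/
  linHolKummer : ∀ X : AutHolOrbispace.{u}, W.KummerStr X (linHolData X)

variable {W}

/-- **Cor 5.2 (vii), the object map of `Th✠ → An✠[Th✠_T] → Th✠_T`**: the CANONICAL panalocal `T`-pair of a panalocal
Galois-theater `V✠` — its local data at `v ∈ V^non` are the `Anab`-data of `Π_v`, at `v ∈ V^arc` the `LinHol`-data of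
`X_v` (given that these are MLF-Galois / Aut-holomorphic `T`-pairs in the vocabulary's sense).
[cite: MochizukiAbsTopIII2015, Cor 5.2 (vii) pp. 120–121] -/
def PanalocalReconstruction.canonical (A : PanalocalReconstruction W) (V : PanalocalGaloisTheater R)
    (hMLF : ∀ v : V.non, W.IsMLFGaloisPair (A.anabAct (V.grp v)))
    (hAH : ∀ v : V.arc, W.IsAutHolPair (A.linHolKummer (V.X v))) : PanalocalTPair W where
  theater := V
  data :=
    { Mnon := fun v => A.anabData (V.grp v)
      actNon := fun v => A.anabAct (V.grp v)
      isMLF := hMLF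
      Marc := fun v => A.linHolData (V.X v)
      kummer := fun v => A.linHolKummer (V.X v)
      isAutHol := hAH }

variable (W)

/-- **Cor 5.2 (vii), essential surjectivity** (named fact; `T ∈ {TF, TM}`; assumption on `(R, W, A)`): every panalocal
`T`-pair is `T`-isomorphic, over the IDENTITY of its panalocal Galois-theater, to the canonical one (Def 3.1 (ii): an
MLF-Galois `T`-pair is isomorphic to a model one; functoriality of Cor 1.10 / Cor 2.7) — with `PanalocalTPairHomDetermined`
and `PanalocalTheaterHomLifts` this is "the natural functors `Th✠ → An✠[Th✠_T] → Th✠_T → Th✠` … are all equivalences of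
categories" (the composite `Th✠ → Th✠` being the identity on the nose here). [cite: MochizukiAbsTopIII2015, Cor 5.2 (vii) p. 121] -/
def PanalocalTPairIsoCanonical (A : PanalocalReconstruction W) (_hT : T ≠ .TLG) : Prop :=
  ∀ Q : PanalocalTPair W, ∃ (hMLF : ∀ v : Q.theater.non, W.IsMLFGaloisPair (A.anabAct (Q.theater.grp v)))
    (hAH : ∀ v : Q.theater.arc, W.IsAutHolPair (A.linHolKummer (Q.theater.X v)))
    (φ : PanalocalTPair.Hom W (A.canonical Q.theater hMLF hAH) Q), φ.φV = PanalocalGaloisTheater.Hom.refl Q.theater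

/-- **Cor 5.2 (vii), faithfulness of `Th✠_T → Th✠`** (named fact; `T ∈ {TF, TM}`; assumption on `(R, W)`): a morphism of
panalocal `T`-pairs is determined by its underlying morphism of panalocal Galois-theaters — the `T`-isomorphisms `φ_v`
are unique (Prop 3.2 (ii), (iv) at nonarchimedean `v`; "`κ_v`, the Kummer structure of `(X_v ↶κ M_v)`" at archimedean
`v` — proof of Cor 5.2, p. 121). [cite: MochizukiAbsTopIII2015, Cor 5.2 (vii) p. 121] -/
def PanalocalTPairHomDetermined (_hT : T ≠ .TLG) : Prop :=
  ∀ (Q₁ Q₂ : PanalocalTPair W) (φ φ' : PanalocalTPair.Hom W Q₁ Q₂), φ.φV = φ'.φV → φ = φ'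

/-- **Cor 5.2 (vii), fullness of `Th✠_T → Th✠`** (named fact; `T ∈ {TF, TM}`; assumption on `(R, W)`): every morphism of
the underlying panalocal Galois-theaters lifts to a morphism of panalocal `T`-pairs (functoriality of the
mono-anabelian reconstruction in open injections of `Orb(TG)` / isomorphisms of `Orb(EA)`). GUARD (audit abc-iut-L6-t22
R5-F1, as in the G1 repair of `GaloisTheaters.lean`): the archimedean components of `f` are representatives
`AutHolOrbispace.Iso` of the STUB, whose `fieldIso` is unconstrained; the lift is asserted only for representatives with
`fieldIso` a homeomorphism (`A_{X₁} ⥲ A_{X₂}` as TOPOLOGICAL fields, Cor 2.9) — the guard evaporates at the merge with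
abc-iut-L4-t2's Aut-holomorphic structure, where `fieldIso` is induced. [cite: MochizukiAbsTopIII2015, Cor 5.2 (vii) p. 121] -/
def PanalocalTheaterHomLifts (_hT : T ≠ .TLG) : Prop :=
  ∀ (Q₁ Q₂ : PanalocalTPair W) (f : PanalocalGaloisTheater.Hom Q₁.theater Q₂.theater),
    (∀ v : Q₁.theater.arc, IsHomeomorph (f.archIso v).fieldIso) → ∃ φ : PanalocalTPair.Hom W Q₁ Q₂, φ.φV = f

/-- **Cor 5.2 (vii)** as one node (`T ∈ {TF, TM}`): the three equivalence facts. [cite: MochizukiAbsTopIII2015, Cor 5.2 (vii) pp. 120–121] -/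
def Cor52vii (A : PanalocalReconstruction W) (hT : T ≠ .TLG) : Prop :=
  PanalocalTPairIsoCanonical W A hT ∧ PanalocalTPairHomDetermined W hT ∧ PanalocalTheaterHomLifts W hT

/-- **Cor 5.2 (vi)** as one node: object part, morphism part and essential surjectivity of the panalocalization of
`T`-pairs. [cite: MochizukiAbsTopIII2015, Cor 5.2 (vi) p. 120] -/
def Cor52vi : Prop :=
  PanalocalTPairExists W ∧ PanalocalTPairMapsHom W ∧ PanalocalTPairEssSurj W

end

end Literature.AnabelianGeometry.AbsoluteAnabelian
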